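import Summits.Langlands.Statement
import Literature.NumberTheory.Automorphic.LocalComponentBJGenericProofs

/-!
# Sketch — crux-ideate stmt-Langlands-17925 (`ReciprocityUpToIrreducibilityR` = R), round 1, k = 2
# Idea `henniart-rigidity-forall-rec`

The ONLY dependence of the summit's correspondence predicate on the reciprocity datum `Rec` is
the class `(Rec.llc v).recGL n (IrrClass.mk πv)` read in `LocalGlobalCompatibleAt` (the `p`-adic
Hodge datum `Rec.pst` ignores `Rec`, by definition).  Local components of cuspidal `π` are
GENERIC (in tree: `CuspidalAutomorphicRepData.exists_isGeneric_of_hasLocalComponentAt`).  Hence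
Henniart's rigidity of the local Langlands correspondence on generic classes
(`LocalGenericRigidity`, Henniart 1993 Thm 1.1 + Henniart 2002 Thm 1.7/1.8) makes `Corresponds`
and `GaloisToAutomorphic` INDEPENDENT of `Rec` (`DatumIndependence`), and the crux R collapses to
`(∀ F, Nonempty (ReciprocityData F)) ∧ E`, where E = `ReciprocityUpToIrreducibility`
(stmt-Langlands-14328, registered tight line `Sketch`).  All glue below is sorry-free.
-/

noncomputable section

open scoped MatrixGroups NumberField Classical
open NumberField IsDedekindDomain Filter
open Literature.NumberTheory.Automorphic Literature.NumberTheory.GaloisRepresentations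
open Summit.Langlands

namespace Summit.Langlands.Langlands.Cruxes.ReciprocityUpToIrreducibilityR.HenniartRigidity

set_option linter.dupNamespace false

/-- VERBATIM local copy of the support decl
`Summit.Langlands.Langlands.Theses.IrreducibilityBySelfDuality.ReciprocityUpToIrreducibility` (item
stmt-Langlands-14328, the `∃ Rec` form E), so that this file depends on `Summits.Langlands.Statement` and
Literature only (the Theses module is being rebuilt on the farm); character-identical body. -/
def E : Prop :=
  ∀ (F : Type) [Field F] [NumberField F], ∃ Rec : ReciprocityData F, ∀ n : ℕ, 0 < n → ∀ hcpt : Literature.NumberTheory.Automorphic.isCompact_glFiniteIntegralLevel n F, (∀ π : Literature.NumberTheory.Automorphic.CuspidalAutomorphicRepData n F hcpt, π.1.IsLAlgebraic → ∀ (ℓ : ℕ) [Fact ℓ.Prime] (ι : PadicAlgCl ℓ ≃+* ℂ), ∃ ρ : Literature.NumberTheory.GaloisRepresentations.FramedGaloisRep F (PadicAlgCl ℓ) n, IsGeometricFramed Rec ρ ∧ Corresponds Rec ι π.1 ρ) ∧ GaloisToAutomorphic n Rec hcpt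

/-- VERBATIM local copy of the crux decl
`Summit.Langlands.Langlands.Theses.IrreducibilityBySelfDuality.ReciprocityUpToIrreducibilityR`
(route file rev 27, item stmt-Langlands-17925), used because the farm's olean of the Theses module
predates rev 25 and lacks the decl (same workaround as the refuter's CruxAttack17925.lean); the
crux-plan seat replaces `R` by the route decl (character-identical body). -/
def R : Prop :=
  ∀ (F : Type) [Field F] [NumberField F], Nonempty (ReciprocityData F) ∧ ∀ (Rec : ReciprocityData F) (n : ℕ), 0 < n → ∀ hcpt : Literature.NumberTheory.Automorphic.isCompact_glFiniteIntegralLevel n F, (∀ π : Literature.NumberTheory.Automorphic.CuspidalAutomorphicRepData n F hcpt, π.1.IsLAlgebraic → ∀ (ℓ : ℕ) [Fact ℓ.Prime] (ι : PadicAlgCl ℓ ≃+* ℂ), ∃ ρ : Literature.NumberTheory.GaloisRepresentations.FramedGaloisRep F (PadicAlgCl ℓ) n, IsGeometricFramed Rec ρ ∧ Corresponds Rec ι π.1 ρ) ∧ GaloisToAutomorphic n Rec hcpt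

/-- **U_gen (local form) — Henniart rigidity on generic classes.**  Two local Langlands data over a
non-archimedean local field whose Artin maps (and the Artin maps of their `ε`-systems at every
finite extension) are THE canonical ones agree on every GENERIC class.  In print: Harris–Taylor
Thm A's list (L/ε of ALL pairs + contragredient) is characterised uniquely (Henniart 1993 Thm 1.1,
Henniart 2002 Thm 1.8); for the tree's six-clause `IsLocalLanglandsGL` (generic pairs, `m < n`, no
contragredient) this is the statement to prove (first lemma of the line; why it might fail: the
named fact `localLanglands_gl` pins supercuspidal classes only and does not record that its
witness maps supercuspidals ONTO irreducible parameters). -/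
def LocalGenericRigidity : Prop :=
  ∀ (F : Type) [Field F] [ValuativeRel F] [TopologicalSpace F] [IsNonarchimedeanLocalField F]
    (L L' : LocalLanglandsDatum F), L.artin.IsCanonical → L'.artin.IsCanonical →
    (∀ (E : Type) [Field E] [ValuativeRel E] [TopologicalSpace E] [IsNonarchimedeanLocalField E]
      [Algebra F E] [FiniteDimensional F E],
        (L.eps.artin E).IsCanonical ∧ (L'.eps.artin E).IsCanonical) →
    ∀ (n : ℕ) (π : SmoothIrrep (GL (Fin n) F)) (ψ : AddChar F Circle),
      ψ.IsContinuousNontrivial → IsGeneric π.ρ ψ →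
        L.recGL n (IrrClass.mk π) = L'.recGL n (IrrClass.mk π)

/-- **U_gen (global reading)**: any two reciprocity data of a number field agree, at every finite
place, on every generic class. -/
def GenericRigidity : Prop :=
  ∀ (K : Type) [Field K] [NumberField K] (Rec Rec' : ReciprocityData K)
    (v : HeightOneSpectrum (𝓞 K)) (n : ℕ) (πv : SmoothIrrep (GL (Fin n) (v.adicCompletion K)))
    (ψ : AddChar (v.adicCompletion K) Circle),
      ψ.IsContinuousNontrivial → IsGeneric πv.ρ ψ →
        (Rec.llc v).recGL n (IrrClass.mk πv) = (Rec'.llc v).recGL n (IrrClass.mk πv)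

/-- **DatumIndependence**: for cuspidal `π`, `Corresponds Rec ι π ρ` does not depend on `Rec`. -/
def DatumIndependence : Prop :=
  ∀ (K : Type) [Field K] [NumberField K] (Rec Rec' : ReciprocityData K) (n : ℕ), 0 < n →
    ∀ (hcpt : isCompact_glFiniteIntegralLevel n K) (π : CuspidalAutomorphicRepData n K hcpt)
      (ℓ : ℕ) [Fact ℓ.Prime] (ι : PadicAlgCl ℓ ≃+* ℂ) (ρ : FramedGaloisRep K (PadicAlgCl ℓ) n),
      Corresponds Rec ι π.1 ρ → Corresponds Rec' ι π.1 ρ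

/-- The pins of `ReciprocityData` feed the local statement: `LocalGenericRigidity → GenericRigidity`. -/
theorem genericRigidity_of_local (hU : LocalGenericRigidity) : GenericRigidity := by
  intro K _ _ Rec Rec' v n πv ψ hψ hgen
  exact hU (v.adicCompletion K) (Rec.llc v) (Rec'.llc v) (Rec.llc_isCanonical v)
    (Rec'.llc_isCanonical v)
    (fun E _ _ _ _ _ _ ↦ ⟨Rec.llc_eps_isCanonical v E, Rec'.llc_eps_isCanonical v E⟩) n πv ψ hψ hgen

/-- `IsGeometricFramed` never depended on `Rec` (the `p`-adic Hodge datum is pinned). -/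
theorem isGeometricFramed_iff {K : Type} [Field K] [NumberField K] (Rec Rec' : ReciprocityData K)
    {ℓ : ℕ} [Fact ℓ.Prime] {n : ℕ} (ρ : FramedGaloisRep K (PadicAlgCl ℓ) n) :
    IsGeometricFramed Rec ρ ↔ IsGeometricFramed Rec' ρ :=
  Iff.rfl

/-- Local–global compatibility at `v` transfers across data agreeing on the class of the local
component. -/
theorem localGlobalCompatibleAt_of_recGL_eq {K : Type} [Field K] [NumberField K]
    (Rec Rec' : ReciprocityData K) {n : ℕ} {hcpt : isCompact_glFiniteIntegralLevel n K}
    {ℓ : ℕ} [Fact ℓ.Prime] (ι : PadicAlgCl ℓ ≃+* ℂ)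
    (π : AutomorphicRepData (AutomorphyDatum.gl n K hcpt)) (ρ : FramedGaloisRep K (PadicAlgCl ℓ) n)
    (v : HeightOneSpectrum (𝓞 K))
    (hagree : ∀ πv : SmoothIrrep (GL (Fin n) (v.adicCompletion K)), π.HasLocalComponentAt v πv.ρ →
      (Rec.llc v).recGL n (IrrClass.mk πv) = (Rec'.llc v).recGL n (IrrClass.mk πv))
    (h : LocalGlobalCompatibleAt Rec ι π ρ v) : LocalGlobalCompatibleAt Rec' ι π ρ v := by
  obtain ⟨πv, r, rℂ, hloc, haway, habove, htrans, hclass⟩ := h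
  refine ⟨πv, r, rℂ, hloc, haway, habove, htrans, ?_⟩
  rw [← hagree πv hloc]
  exact hclass

/-- **GenericRigidity → DatumIndependence** (local components of cuspidal data are generic:
`CuspidalAutomorphicRepData.exists_isGeneric_of_hasLocalComponentAt`, in tree). -/
theorem datumIndependence_of_genericRigidity (hU : GenericRigidity) : DatumIndependence := by
  intro K _ _ Rec Rec' n hn hcpt π ℓ _ ι ρ h
  haveI : NeZero n := ⟨Nat.pos_iff_ne_zero.mp hn⟩
  refine ⟨h.1, fun v ↦ localGlobalCompatibleAt_of_recGL_eq Rec Rec' ι π.1 ρ v ?_ (h.2 v)⟩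
  intro πv hloc
  haveI := πv.isIrreducible
  obtain ⟨ψ, hψ, hgen⟩ :=
    CuspidalAutomorphicRepData.exists_isGeneric_of_hasLocalComponentAt π v πv.ρ πv.isSmooth hloc
  exact hU K Rec Rec' v n πv ψ hψ hgen

/-- **The collapse.**  Under datum-independence the crux R is EXACTLY the non-vacuity conjunct plus
the `∃ Rec` form E (stmt-Langlands-14328). -/
theorem reciprocityUpToIrreducibilityR_iff (hD : DatumIndependence) :
    R ↔
      (∀ (F : Type) [Field F] [NumberField F], Nonempty (ReciprocityData F)) ∧
        E := by
  constructor
  · intro hR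
    refine ⟨fun F _ _ ↦ (hR F).1, fun F _ _ ↦ ?_⟩
    obtain ⟨⟨Rec⟩, h⟩ := hR F
    exact ⟨Rec, fun n hn hcpt ↦ h Rec n hn hcpt⟩
  · rintro ⟨hN, hE⟩ F _ _
    refine ⟨hN F, fun Rec n hn hcpt ↦ ?_⟩
    obtain ⟨Rec₀, h₀⟩ := hE F
    obtain ⟨hA, hB⟩ := h₀ n hn hcpt
    refine ⟨fun π hπ ℓ _ ι ↦ ?_, fun ℓ _ ι ρ hirr hgeo ↦ ?_⟩
    · obtain ⟨ρ, hgeo, hcorr⟩ := hA π hπ ℓ ι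
      exact ⟨ρ, (isGeometricFramed_iff Rec₀ Rec ρ).1 hgeo, hD F Rec₀ Rec n hn hcpt π ℓ ι ρ hcorr⟩
    · obtain ⟨π, hπ, hcorr⟩ := hB ℓ ι ρ hirr ((isGeometricFramed_iff Rec Rec₀ ρ).1 hgeo)
      exact ⟨π, hπ, hD F Rec₀ Rec n hn hcpt π ℓ ι ρ hcorr⟩

/-- **First lemma of the line, composed**: Henniart rigidity (local, printed) + existence of
canonically pinned data + E give R by name. -/
theorem reciprocityUpToIrreducibilityR_of
    (hN : ∀ (F : Type) [Field F] [NumberField F], Nonempty (ReciprocityData F))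
    (hU : LocalGenericRigidity) (hE : E) :
    R :=
  (reciprocityUpToIrreducibilityR_iff
    (datumIndependence_of_genericRigidity (genericRigidity_of_local hU))).2 ⟨hN, hE⟩

/-- Conversely R hands back both inputs other than rigidity (no datum-independence needed). -/
theorem nonempty_and_reciprocityUpToIrreducibility_of (hR : R) :
    (∀ (F : Type) [Field F] [NumberField F], Nonempty (ReciprocityData F)) ∧
      E := by
  refine ⟨fun F _ _ ↦ (hR F).1, fun F _ _ ↦ ?_⟩
  obtain ⟨⟨Rec⟩, h⟩ := hR F
  exact ⟨Rec, fun n hn hcpt ↦ h Rec n hn hcpt⟩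


/-! ## §2  The supercuspidal floor of `LocalGenericRigidity` from the tree's named facts

What the pins buy TODAY: two canonically pinned data have equal Artin data (`LocalArtinData` is
determined by its map) and `ε`-systems with equal Artin data, hence (named fact
`localEpsilonSystem_unique`, Deligne 1973 Thm 4.1) equal `ε₀` on continuous non-trivial `ψ`; so
the second datum's `recGL` is a local Langlands correspondence for the FIRST datum's normalising
pair `(d, 𝓔)`, and the uniqueness half of the named fact `localLanglands_gl` (Henniart 1993,
supercuspidal classes) applies.  Generic NON-supercuspidal classes are exactly what is left for the
line (Henniart 2002 Thm 1.7/1.8 + a full-list existence witness). -/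

section SupercuspidalFloor

open MeasureTheory

variable {F : Type} [Field F] [ValuativeRel F] [TopologicalSpace F] [IsNonarchimedeanLocalField F]

/-- A local Artin datum is determined by its Artin map (the other fields are propositions). -/
theorem localArtinData_eq_of_artin_eq {d d' : LocalArtinData F} (h : d.artin = d'.artin) : d = d' := by
  cases d; cases d'; cases h; rfl

/-- Two canonical data are equal. -/
theorem eq_of_isCanonical {d d' : LocalArtinData F} (h : d.IsCanonical) (h' : d'.IsCanonical) :
    d = d' :=
  localArtinData_eq_of_artin_eq (h.artin_eq h')

/-- `epsilonWD` only reads `ε₀` on the base field, at the given (continuous non-trivial) `ψ`. -/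
theorem epsilonWD_congr_eps [MeasurableSpace F] [BorelSpace F]
    (hmul : IsFrobPow.mul (F := F)) (huniq : IsFrobPow.unique (F := F))
    (hn : absInertia_normal F) (hex : exists_isFrobPow (F := F))
    {𝓔 𝓔' : LocalEpsilonSystem F} (hart : 𝓔.artin = 𝓔'.artin)
    (hεu : localEpsilonSystem_unique (F := F))
    {V : Type} [AddCommGroup V] [Module ℂ V] [FiniteDimensional ℂ V]
    (ψ : AddChar F Circle) (hψ : ψ.IsContinuousNontrivial) (μ : Measure F) [μ.IsAddHaarMeasure]
    (r : WeilDeligneRep F ℂ V) (s : ℂ) :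
    epsilonWD hmul huniq hn hex 𝓔 ψ μ r s = epsilonWD hmul huniq hn hex 𝓔' ψ μ r s := by
  unfold epsilonWD
  rw [hεu 𝓔 𝓔' hart F ψ μ _ hψ]

/-- Transport of the six-clause property along `ε`-systems with the same Artin data. -/
theorem isLocalLanglandsGL_of_eps_artin_eq
    {hmul : IsFrobPow.mul (F := F)} {huniq : IsFrobPow.unique (F := F)}
    {hn : absInertia_normal F} {hex : exists_isFrobPow (F := F)}
    {hns : WeilGroup.exists_subgroup_le_inertia_isOpen_of_continuous (F := F)}
    {d : LocalArtinData F} {𝓔 𝓔' : LocalEpsilonSystem F} (hart : 𝓔.artin = 𝓔'.artin)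
    (hεu : localEpsilonSystem_unique (F := F))
    {rec : ∀ n : ℕ, IrrClass (GL (Fin n) F) → Quotient (frobSemisimpleWDSetoid F n)}
    (h : IsLocalLanglandsGL F hmul huniq hn hex hns d 𝓔 rec) :
    IsLocalLanglandsGL F hmul huniq hn hex hns d 𝓔' rec where
  bijective := h.bijective
  gl_one := h.gl_one
  lFactor_pairs := h.lFactor_pairs
  epsilon_pairs := by
    intro m n hm hmn π π' ψ hψ hg hg' _ _ μ _ hsd _ _ ν _ _ _ e a
    rw [h.epsilon_pairs hm hmn π π' ψ hψ hg hg' μ hsd ν e a]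
    refine forall_congr' fun s ↦ ?_
    rw [epsilonWD_congr_eps hmul huniq hn hex hart hεu ψ hψ μ _ s]
  twist := h.twist
  centralChar := h.centralChar

/-- **Supercuspidal floor.**  For two local Langlands data with canonical Artin pins (base field and
every finite extension), the named facts `localEpsilonSystem_unique` (Deligne) and
`localLanglands_gl` (Harris–Taylor + Henniart 1993, uniqueness half) give agreement on every
SUPERCUSPIDAL class.  `LocalGenericRigidity` asks for the generic classes. -/
theorem recGL_eq_of_isSupercuspidal (hεu : localEpsilonSystem_unique (F := F))
    (L L' : LocalLanglandsDatum F)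
    (hS09 : localLanglands_gl F L.hmul L.huniq L.hn L.hex L.hns L.artin L.eps L.eps_artin)
    (hL : L.artin.IsCanonical) (hL' : L'.artin.IsCanonical)
    (hε : ∀ (E : Type) [Field E] [ValuativeRel E] [TopologicalSpace E] [IsNonarchimedeanLocalField E]
      [Algebra F E] [FiniteDimensional F E],
        (L.eps.artin E).IsCanonical ∧ (L'.eps.artin E).IsCanonical)
    {n : ℕ} (c : IrrClass (GL (Fin n) F)) (hc : c.IsSupercuspidal) :
    L.recGL n c = L'.recGL n c := by
  -- the two `ε`-systems have the same Artin data
  have hart : L'.eps.artin = L.eps.artin := by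
    funext E _ _ _ _ _ _
    exact eq_of_isCanonical (hε E).2 (hε E).1
  -- the two base Artin data coincide
  have hd : L'.artin = L.artin := eq_of_isCanonical hL' hL
  -- `L'.recGL` is a local Langlands correspondence for `(L.artin, L.eps)`
  have h' : IsLocalLanglandsGL F L.hmul L.huniq L.hn L.hex L.hns L.artin L.eps L'.recGL := by
    have h₀ : IsLocalLanglandsGL F L.hmul L.huniq L.hn L.hex L.hns L'.artin L'.eps L'.recGL :=
      L'.isLocalLanglands
    rw [hd] at h₀
    exact isLocalLanglandsGL_of_eps_artin_eq hart hεu h₀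
  exact IsLocalLanglandsGL.unique_of_isSupercuspidal F L.hmul L.huniq L.hn L.hex L.hns
    L.eps_artin hS09 L.isLocalLanglands h' c hc

end SupercuspidalFloor

/-! ## §3  The line's stubs, typed (Henniart 2002) -/

/-- **P-GR — Galois-side Euler rigidity** (Henniart 2002, BSMF 130, Thm 1.7 (a), in Euler-factor
form): a Frobenius-semisimple Weil–Deligne representation of dimension `n` that is NOT irreducible
is determined up to isomorphism by the Euler factors of its tensor products with the
Frobenius-semisimple indecomposable representations of dimension `m < n`.  Elementary over the
tree's `WeilDeligneRep.eulerFactor` / `tprod` (provable now, size M–L; no named fact). -/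
def GaloisEulerRigidity : Prop :=
  ∀ (F : Type) [Field F] [ValuativeRel F] [TopologicalSpace F] [IsNonarchimedeanLocalField F]
    (hn : absInertia_normal F) (hex : exists_isFrobPow (F := F)) (n : ℕ)
    (σ σ' : WeilDeligneRep F ℂ (Fin n → ℂ)), σ.IsFrobSemisimple → σ'.IsFrobSemisimple →
    ¬ σ.IsIrreducible →
    (∀ (m : ℕ), m < n → ∀ τ : WeilDeligneRep F ℂ (Fin m → ℂ), τ.IsFrobSemisimple →
      τ.IsIndecomposable →
        (σ.tprod τ).eulerFactor hn hex = (σ'.tprod τ).eulerFactor hn hex) →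
    σ.IsEquivalent σ'

end Summit.Langlands.Langlands.Cruxes.ReciprocityUpToIrreducibilityR.HenniartRigidity

end
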